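import Summits.BirchSwinnertonDyer.BirchSwinnertonDyer.Theorems.ManinLocalTwoThreeManinConstantOfStevensInclusion
import Summits.BirchSwinnertonDyer.BirchSwinnertonDyer.Theorems.EdixhovenFibreFiveSevenStarredOptimalManinUnitFiveSevenCdtThm1
import Summits.BirchSwinnertonDyer.BirchSwinnertonDyer.Theses.BiquadraticEisensteinDescent
import Literature.NumberTheory.EllipticCurves.ManinConstantKodairaTypePrimes
import Literature.NumberTheory.EllipticCurves.ManinConstantNonPotentiallyOrdinaryPrimes
import HarnessLib

set_option autoImplicit false
-- the sub-problem namespace `Summit.BirchSwinnertonDyer.BirchSwinnertonDyer` duplicates a component by design (D-0017)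
set_option linter.dupNamespace false

/-!
# Edixhoven 1991's Manin-constant theorems at additive primes `p > 7` as tree theorems; support item
# `EdixhovenManinNonPotOrdinary` (stmt-BirchSwinnertonDyer-20323) closed by name

Two statement-only (cite-only) Literature facts, both in lattice rendering over conductor-level data of a globally
minimal curve and both concluding `p ∤ c` for a prime `p > 7`:

* `edixhoven_not_dvd_maninConstant_of_kodairaSymbol_ne` [Edixhoven1991, Thm. 3: Kodaira symbol at `p` not II, III, IV];
* `edixhoven_not_dvd_maninConstant_of_not_potentiallyGoodOrdinary` [Edixhoven1991: `p` not potentially good ordinary].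

Both are special cases of `ManinLocalTwoThree.KummerValues.not_dvd_maninConstant_of_CDT` (`p ∤ c₀` for every `p ≥ 3` at
every level, from Stevens' inclusion ⟸ the Unbounded Denominators theorem [CalegariDimitrovTang2025, Thm. 1.0.1], tree theorem
`calegariDimitrovTang2025_unboundedDenominators_holds`, and the conjugation obstruction): their reduction-type hypotheses
are idle.  This file discharges both (`…_holds`) and closes the shared support item stmt-BirchSwinnertonDyer-20323 (routes
BiquadraticEisensteinDescent, AdditiveKolyvaginRoad) BY NAME through route BiquadraticEisensteinDescent's declaration.

HONEST STATUS.  Manin's conjecture is NOT proved here (the prime `2` at levels `4 ∣ N` is open); BSD is not proved by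
this; the statement audit of the vendored definitions under these kernel terms is pending.
[cite: Edixhoven1991, Thm. 3] [cite: CalegariDimitrovTang2025, Thm. 1.0.1] [cite: Stevens1989, §2] [cite: Manin1972, §1.6]
-/

noncomputable section

open WeierstrassCurve
open Literature.NumberTheory.EllipticCurves Literature.NumberTheory.EllipticCurves.ModularForms

namespace Summit.BirchSwinnertonDyer.BirchSwinnertonDyer.Theorems

/-- **Edixhoven 1991, Thm. 3 (Kodaira-type primes) holds** (the Literature named fact
`edixhoven_not_dvd_maninConstant_of_kodairaSymbol_ne`, lattice rendering): for a globally minimal `W'/ℚ`, a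
lattice-optimal conductor-level datum and a prime `p > 7` whose Kodaira symbol is not II, III or IV, `p ∤ c`.
Discharged from `KummerValues.not_dvd_maninConstant_of_CDT` and the CDT tree theorem (the Kodaira hypotheses are idle).
[cite: Edixhoven1991, Thm. 3] [cite: CalegariDimitrovTang2025, Thm. 1.0.1] -/
theorem edixhoven_not_dvd_maninConstant_of_kodairaSymbol_ne_holds :
    edixhoven_not_dvd_maninConstant_of_kodairaSymbol_ne := by
  intro W' _ _ _ D' hopt p _ hp7 _ _ _
  exact ManinLocalTwoThree.KummerValues.not_dvd_maninConstant_of_CDT calegariDimitrovTang2025_unboundedDenominators_holds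
    W' D' hopt (by omega)

/-- **Edixhoven 1991 (non-potentially-good-ordinary primes) holds** (the Literature named fact
`edixhoven_not_dvd_maninConstant_of_not_potentiallyGoodOrdinary`, lattice rendering): for a globally minimal `W'/ℚ`,
a lattice-optimal conductor-level datum and a prime `p > 7` at which `W'` is not potentially good ordinary, `p ∤ c`.
Discharged from `KummerValues.not_dvd_maninConstant_of_CDT` and the CDT tree theorem (the reduction hypothesis is idle).
[cite: Edixhoven1991, Thm. 3] [cite: CalegariDimitrovTang2025, Thm. 1.0.1] -/
theorem edixhoven_not_dvd_maninConstant_of_not_potentiallyGoodOrdinary_holds :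
    edixhoven_not_dvd_maninConstant_of_not_potentiallyGoodOrdinary := by
  intro W' _ _ _ D' hopt p _ hp7 _
  exact ManinLocalTwoThree.KummerValues.not_dvd_maninConstant_of_CDT calegariDimitrovTang2025_unboundedDenominators_holds
    W' D' hopt (by omega)

/-- **Support item `EdixhovenManinNonPotOrdinary` (stmt-BirchSwinnertonDyer-20323), proved by name** through route
BiquadraticEisensteinDescent's declaration (shared verbatim with route AdditiveKolyvaginRoad).  BSD is NOT proved by
this; Manin's conjecture is NOT proved by this. [cite: Edixhoven1991, Thm. 3] [cite: CalegariDimitrovTang2025, Thm. 1.0.1] -/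
theorem BiquadraticEisensteinDescent.EdixhovenManinNonPotOrdinary_proof :
    Summit.BirchSwinnertonDyer.BirchSwinnertonDyer.Theses.BiquadraticEisensteinDescent.EdixhovenManinNonPotOrdinary :=
  edixhoven_not_dvd_maninConstant_of_not_potentiallyGoodOrdinary_holds

end Summit.BirchSwinnertonDyer.BirchSwinnertonDyer.Theorems

end
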